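import Summits.CriticalPhenomena.SAWScalingLimit.Theorems.SAWLeftRightFKGFKGToTraversalBoundGreenDecomposition
import Literature.Probability.LatticeModels.LatticeHarnackOneScale
import Literature.Probability.LatticeModels.LatticeHarmonicMeasure
import HarnessLib

/-!
# Weak Beurling near the wall of a hole-free lattice domain, for Dirichlet Green functions

Support file for stub `stub_killedWalkCollarBound` (line `excursion-domination`, crux `FKGToTraversalBound`,
stmt-CriticalPhenomena-1878, route `SAWLeftRightFKG`): the potential theory behind the part of the
killed-walk collar bound that the tree settles (companion files `…KilledWalkCollarDetour.lean`,
`…KilledWalkCollarBound.lean`).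

* §1 The Dirichlet Green function `G_Λ = dirichletGreen Λ` of a finite `Λ ⊆ ℤ²` in the language of
  `LatticeLaplacian.lean`: `Δ_x G_Λ(x,b) = -[b = x]` on `Λ`; the far correction
  `G_Λ(·,b) - G_{Λ'}(·,b)` (`Λ' ⊆ Λ`) is lattice harmonic on `Λ'`; `G_Λ(·,b)` is harmonic off the pole;
  `G_Λ(x,b) ≤ G_Λ(b,b)` (maximum principle); `G_Λ(b,b) ≥ 1/4` on `Λ`; `G_{Λ∖F} ≤ G_{Λ∖H}` for
  `H ∩ Λ ⊆ F`.
* §2 Mesh points (`meshPoint δ`), Euclidean distances and the lattice boxes `sqBox` of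
  `WeakBeurlingEstimate.lean`.
* §3 `le_near_wall` / the registered worker sub-goal `stub_killedWalkWallBeurling`: for a hole-free `Λ`
  (`HoleFree`), `T ⊆ Λ`, `h` lattice harmonic on `T`, `≤ 1` on `∂T` and `≤ 0` on `∂T` within `R` of a
  centre `z₀`, and a wall site `p ∉ Λ` within `r + δ` of `z₀` (`δ ≤ r`, `M r ≤ R`, `M > 2`):
  `h ≤ C_B (12/(M-2))^{β_B}` on `T` within `r + δ` of `z₀` — the tree's weak Beurling estimate
  (`le_add_rpow_of_cutPath`, Smirnov 2010 Lemma B.2 after Kesten, fully proved there) about the base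
  point `p`, which `HoleFree` joins to infinity off `Λ`; only the conversion between Euclidean radii at
  mesh `δ` and lattice boxes is done here.
Everything is proved; no named fact is used. [folklore]
-/

noncomputable section

open SimpleGraph
open Literature.Probability.LatticeModels
open Literature.Probability.LatticeModels.WeakBeurling (sqBox mem_sqBox beurlingConst beurlingExp
  beurlingConst_pos beurlingExp_pos mem_latticeOuterBoundary_iff)

namespace Summit.CriticalPhenomena.SAWScalingLimit.Theorems.FKGToTraversalBound.ExcursionDomination.KilledWalkCollar

/-! ## §1 Potential theory of the Dirichlet Green function on `ℤ²` -/

/-- The two lattice Laplacians of the tree agree on `ℤ²` (local copy of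
`latticeLaplacian_eq_latticeLaplacianZd` of `HarmonicFlatBoundaryRow.lean`, kept out of the import
cone). [folklore] -/
private theorem latticeLaplacian_eq_zd (H : Site 2 → ℝ) (v : Site 2) :
    latticeLaplacian H v = latticeLaplacianZd H v := by
  rw [latticeLaplacian, Fin.sum_univ_four, latticeLaplacianZd_def, Fin.sum_univ_two]
  simp only [cornerUnit, ← sub_eq_add_neg]
  push_cast
  ring

/-- **Poisson equation in the first variable**: `Δ_x G_Λ(x,b) = -[b = x]` on `Λ` (symmetry
`dirichletGreen_comm` and `neg_latticeLaplacianZd_dirichletGreen`). [folklore] -/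
theorem latticeLaplacian_dirichletGreen_left (Λ : Finset (Site 2)) (b : Site 2) {z : Site 2}
    (hz : z ∈ Λ) : latticeLaplacian (fun x => dirichletGreen Λ x b) z = -(if b = z then 1 else 0) := by
  have hF : (fun x => dirichletGreen Λ x b) = dirichletGreen Λ b := funext fun x => dirichletGreen_comm Λ x b
  rw [hF, latticeLaplacian_eq_zd, ← neg_latticeLaplacianZd_dirichletGreen two_pos Λ b hz, neg_neg]

/-- **The far correction is harmonic**: for `Λ' ⊆ Λ`, `x ↦ G_Λ(x,b) - G_{Λ'}(x,b)` is lattice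
harmonic on `Λ'` (both terms have Laplacian `-[b = x]` there). [folklore] -/
theorem isLatticeHarmonicOn_dirichletGreen_sub {Λ Λ' : Finset (Site 2)} (h : Λ' ⊆ Λ) (b : Site 2) :
    IsLatticeHarmonicOn (fun x => dirichletGreen Λ x b - dirichletGreen Λ' x b) ↑Λ' := by
  intro z hz
  have hz' : z ∈ Λ' := hz
  have := latticeLaplacian_sub (fun x => dirichletGreen Λ x b) (fun x => dirichletGreen Λ' x b) z
  rw [latticeLaplacian_dirichletGreen_left Λ b (h hz'), latticeLaplacian_dirichletGreen_left Λ' b hz',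
    sub_self] at this
  exact this

/-- `G_Λ(·, b)` is lattice harmonic off the pole: on `Λ ∖ {b}`. [folklore] -/
theorem isLatticeHarmonicOn_dirichletGreen_off_pole (Λ : Finset (Site 2)) (b : Site 2) :
    IsLatticeHarmonicOn (fun x => dirichletGreen Λ x b) (↑Λ \ {b}) := by
  intro z hz
  rw [latticeLaplacian_dirichletGreen_left Λ b hz.1, if_neg, neg_zero]
  rintro rfl
  exact hz.2 rfl

/-- **`G_Λ(x,b) ≤ G_Λ(b,b)`** (maximum principle for the harmonic function `G_Λ(·,b)` on
`Λ ∖ {b}`, which vanishes off `Λ`). [folklore] -/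
theorem dirichletGreen_le_diag (Λ : Finset (Site 2)) (x b : Site 2) :
    dirichletGreen Λ x b ≤ dirichletGreen Λ b b := by
  have h0 := dirichletGreen_nonneg two_pos Λ b b
  by_cases hb : b ∈ Λ
  · by_cases hxb : x = b
    · rw [hxb]
    by_cases hx : x ∈ Λ
    · have hS : ((↑Λ : Set (Site 2)) \ {b}).Finite := Λ.finite_toSet.subset Set.sdiff_subset
      refine (isLatticeHarmonicOn_dirichletGreen_off_pole Λ b).subharmonicOn.le_of_forall_boundary_le hS
        (M := dirichletGreen Λ b b) (fun w hw => ?_) x ⟨hx, hxb⟩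
      by_cases hwb : w = b
      · rw [hwb]
      · have hwΛ : w ∉ Λ := fun h => hw.1 ⟨h, hwb⟩
        rw [dirichletGreen_of_not_mem_left Λ hwΛ]; exact h0
    · rw [dirichletGreen_of_not_mem_left Λ hx]; exact h0
  · rw [dirichletGreen_of_not_mem_right Λ x hb]; exact h0

/-- **`G_Λ(b,b) ≥ 1/4 > 0` for `b ∈ Λ`**: `4 G_Λ(b,b) = 1 + ∑_{w ∼ b} G_Λ(b,w) ≥ 1`. [folklore] -/
theorem dirichletGreen_diag_pos {Λ : Finset (Site 2)} {b : Site 2} (hb : b ∈ Λ) : 0 < dirichletGreen Λ b b := by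
  have h := sum_neighborFinset_dirichletGreen two_pos Λ b hb
  rw [if_pos rfl] at h
  have hnn : 0 ≤ ∑ w ∈ (zdGraph 2).neighborFinset b, dirichletGreen Λ b w :=
    Finset.sum_nonneg fun w _ => dirichletGreen_nonneg two_pos Λ b w
  push_cast at h
  linarith

/-- Removing more sites decreases the Green function: `G_{Λ∖F} ≤ G_{Λ∖H}` when `H ∩ Λ ⊆ F`.
[folklore] -/
theorem dirichletGreen_sdiff_le_sdiff {Λ F H : Finset (Site 2)} (hHF : ∀ e ∈ H, e ∈ Λ → e ∈ F) (a b : Site 2) :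
    dirichletGreen (Λ \ F) a b ≤ dirichletGreen (Λ \ H) a b := by
  have hset : Λ \ F = (Λ \ H) \ F := by
    ext x
    simp only [Finset.mem_sdiff]
    exact ⟨fun h => ⟨⟨h.1, fun hxH => h.2 (hHF x hxH h.1)⟩, h.2⟩, fun h => ⟨h.1.1, h.2⟩⟩
  rw [hset]
  exact dirichletGreen_sdiff_le two_pos _ _ a b

/-! ## §2 Mesh points, Euclidean distances and lattice boxes -/

/-- A coordinate difference is at most the Euclidean mesh distance divided by `δ`. [folklore] -/
theorem abs_coord_sub_le {δ : ℝ} (hδ : 0 < δ) (x p : Site 2) (i : Fin 2) :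
    |((x i : ℤ) : ℝ) - p i| ≤ dist (meshPoint δ x) (meshPoint δ p) / δ := by
  rw [le_div_iff₀ hδ, dist_eq_norm]
  have hsub : meshPoint δ x - meshPoint δ p = (δ : ℂ) * (Site.toComplex x - Site.toComplex p) := by
    simp only [meshPoint]; ring
  rw [hsub, norm_mul, Complex.norm_real, Real.norm_eq_abs, abs_of_pos hδ, mul_comm]
  refine mul_le_mul_of_nonneg_left ?_ hδ.le
  fin_cases i
  · simpa [Site.toComplex] using Complex.abs_re_le_norm (Site.toComplex x - Site.toComplex p)
  · simpa [Site.toComplex] using Complex.abs_im_le_norm (Site.toComplex x - Site.toComplex p)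

/-- A site of the box `sqBox p n` lies within `r + δ + 2δn` of a centre within `r + δ` of `δp`.
[folklore] -/
theorem dist_le_of_mem_sqBox {δ r : ℝ} (hδ : 0 ≤ δ) {z₀ : ℂ} {p w : Site 2} {n : ℕ} (hw : w ∈ sqBox p n)
    (hp : dist (meshPoint δ p) z₀ ≤ r + δ) : dist (meshPoint δ w) z₀ ≤ r + δ + 2 * δ * n := by
  -- `|δw - δp| ≤ δ (|w₀ - p₀| + |w₁ - p₁|)`: the Euclidean norm is at most the `ℓ¹` norm
  have h1 : dist (meshPoint δ w) (meshPoint δ p) ≤ δ * (|((w 0 : ℤ) : ℝ) - p 0| + |((w 1 : ℤ) : ℝ) - p 1|) := by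
    rw [dist_eq_norm]
    have hsub : meshPoint δ w - meshPoint δ p = (δ : ℂ) * (Site.toComplex w - Site.toComplex p) := by
      simp only [meshPoint]; ring
    rw [hsub, norm_mul, Complex.norm_real, Real.norm_eq_abs, abs_of_nonneg hδ]
    refine mul_le_mul_of_nonneg_left ((Complex.norm_le_abs_re_add_abs_im _).trans (le_of_eq ?_)) hδ
    simp [Site.toComplex]
  rw [mem_sqBox] at hw
  have h0 : |((w 0 : ℤ) : ℝ) - p 0| ≤ n := by exact_mod_cast hw.1
  have h1' : |((w 1 : ℤ) : ℝ) - p 1| ≤ n := by exact_mod_cast hw.2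
  have htri := dist_triangle (meshPoint δ w) (meshPoint δ p) z₀
  nlinarith

/-- A site within `r + δ` of the centre lies in the box `sqBox p ρ` about a site `p` within `r + δ` of
the centre, as soon as `(2r + 2δ)/δ ≤ ρ`. [folklore] -/
theorem mem_sqBox_of_dist_lt {δ r : ℝ} (hδ : 0 < δ) {z₀ : ℂ} {p x : Site 2} {ρ : ℕ}
    (hx : dist (meshPoint δ x) z₀ < r + δ) (hp : dist (meshPoint δ p) z₀ ≤ r + δ) (hρ : (2 * r + 2 * δ) / δ ≤ ρ) :
    x ∈ sqBox p ρ := by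
  have hd : dist (meshPoint δ x) (meshPoint δ p) / δ ≤ ρ := by
    refine le_trans (div_le_div_of_nonneg_right ?_ hδ.le) hρ
    linarith [dist_triangle_right (meshPoint δ x) (meshPoint δ p) z₀]
  rw [mem_sqBox]
  constructor
  · exact_mod_cast (abs_coord_sub_le hδ x p 0).trans hd
  · exact_mod_cast (abs_coord_sub_le hδ x p 1).trans hd

/-! ## §3 Weak Beurling near the wall of a hole-free domain -/

/-- **A harmonic function vanishing on the boundary inside the collar is small near the wall.** Let
`Λ` be hole-free and `T ⊆ Λ`; let `h` be lattice harmonic on `T`, `≤ 1` on `∂T`, and `≤ 0` at the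
points of `∂T` within `R` of the centre `z₀`; let `p ∉ Λ` lie within `r + δ` of `z₀` (the wall), with
`δ ≤ r`, `M r ≤ R`, `M > 2`. Then `h ≤ C_B (12/(M-2))^{β_B}` at every site of `T` within `r + δ` of `z₀`
(`weakBeurling_of_cutPath` / `le_add_rpow_of_cutPath` about the base point `p`, which is joined to the
outside of the box `sqBox p n`, `2δ(n+1) > R - r - δ`, by a lattice path off `Λ` — `HoleFree` —; the
sites within `r + δ` of `z₀` lie in `sqBox p ρ`, `ρ + 1 ≤ 6r/δ`). [folklore] -/
theorem le_near_wall {δ r R M : ℝ} {Λ : Finset (Site 2)} (hΛ : HoleFree (↑Λ : Set (Site 2)))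
    {T : Set (Site 2)} (hTΛ : T ⊆ ↑Λ) {h : Site 2 → ℝ} (hh : IsLatticeHarmonicOn h T)
    (h1 : ∀ w ∈ latticeOuterBoundary T, h w ≤ 1) {z₀ : ℂ}
    (h0 : ∀ w ∈ latticeOuterBoundary T, dist (meshPoint δ w) z₀ ≤ R → h w ≤ 0)
    {p : Site 2} (hp : p ∉ Λ) (hpz : dist (meshPoint δ p) z₀ ≤ r + δ)
    (hδ : 0 < δ) (hr : δ ≤ r) (hM : 2 < M) (hR : M * r ≤ R) {x : Site 2} (hxT : x ∈ T)
    (hx : dist (meshPoint δ x) z₀ < r + δ) :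
    h x ≤ beurlingConst * (12 / (M - 2)) ^ beurlingExp := by
  have hT : T.Finite := Λ.finite_toSet.subset hTΛ
  have hr0 : 0 < r := hδ.trans_le hr
  have hR2 : 2 * r < R := lt_of_lt_of_le (by nlinarith) hR
  -- the two boxes about the wall site `p`
  set n : ℕ := ⌊(R - r - δ) / (2 * δ)⌋₊ with hn
  set ρ : ℕ := ⌈(2 * r + 2 * δ) / δ⌉₊ with hρ
  have hn_le : (n : ℝ) ≤ (R - r - δ) / (2 * δ) := Nat.floor_le (by apply div_nonneg <;> linarith)
  have hn_gt : (R - r - δ) / (2 * δ) < n + 1 := Nat.lt_floor_add_one _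
  have hρ_ge : (2 * r + 2 * δ) / δ ≤ ρ := Nat.le_ceil _
  have hρ_lt : (ρ : ℝ) < (2 * r + 2 * δ) / δ + 1 := Nat.ceil_lt_add_one (by positivity)
  -- the cut path from `p` out of the box, off `Λ`
  obtain ⟨g', hg'1, hpath⟩ := hΛ p hp (p 1 + n + 1)
  obtain ⟨q, hq⟩ := exists_walk_of_faceStep hpath hp
  have hg' : g' ∉ sqBox p n := by
    rw [mem_sqBox, not_and_or]; right; rw [abs_le]; push Not; intro; linarith
  -- boundary values inside the box vanish
  have hη : ∀ w ∈ latticeOuterBoundary T, w ∈ sqBox p n → h w ≤ 0 := by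
    intro w hw hwn
    refine h0 w hw ((dist_le_of_mem_sqBox hδ.le hwn hpz).trans ?_)
    have : 2 * δ * n ≤ R - r - δ := by
      have := mul_le_mul_of_nonneg_left hn_le (by linarith : (0 : ℝ) ≤ 2 * δ)
      rwa [mul_div_cancel₀ _ (by positivity : (2 : ℝ) * δ ≠ 0)] at this
    linarith
  have key := le_add_rpow_of_cutPath hT hh.subharmonicOn h1 (η := 0) le_rfl hη q hg'
    (fun z hz hzT => hq z hz (hTΛ hzT)) hxT (mem_sqBox_of_dist_lt hδ hx hpz hρ_ge)
  rw [zero_add] at key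
  refine key.trans (mul_le_mul_of_nonneg_left ?_ beurlingConst_pos.le)
  refine Real.rpow_le_rpow (by positivity) ?_ beurlingExp_pos.le
  -- `(ρ + 1)/(n + 1) ≤ 12/(M - 2)`
  have hnum : (ρ : ℝ) + 1 ≤ 6 * r / δ := by
    have : (2 * r + 2 * δ) / δ + 2 ≤ 6 * r / δ := by
      rw [div_add' _ _ _ hδ.ne', div_le_div_iff_of_pos_right hδ]; nlinarith
    linarith
  have hden : (R - 2 * r) / (2 * δ) ≤ (n : ℝ) + 1 := by
    have : (R - 2 * r) / (2 * δ) ≤ (R - r - δ) / (2 * δ) := div_le_div_of_nonneg_right (by linarith) (by linarith)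
    linarith
  have hden0 : 0 < (R - 2 * r) / (2 * δ) := div_pos (by linarith) (by linarith)
  calc ((ρ : ℝ) + 1) / ((n : ℝ) + 1) ≤ (6 * r / δ) / ((R - 2 * r) / (2 * δ)) := by
        gcongr
      _ = 12 * r / (R - 2 * r) := by field_simp; ring
      _ ≤ 12 * r / ((M - 2) * r) := by
        apply div_le_div_of_nonneg_left (by positivity) (by nlinarith) (by nlinarith)
      _ = 12 / (M - 2) := by field_simp

/-- **Worker sub-goal `stub_killedWalkWallBeurling`** of stub `stub_killedWalkCollarBound` (registered,
def-free): `le_near_wall` in closed form. [folklore] -/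
theorem stub_killedWalkWallBeurling :
    ∀ (δ r R M : ℝ) (Λ : Finset (Site 2)) (T : Set (Site 2)) (h : Site 2 → ℝ) (z₀ : ℂ) (p x : Site 2),
    HoleFree (↑Λ : Set (Site 2)) → T ⊆ ↑Λ → IsLatticeHarmonicOn h T → (∀ w ∈ latticeOuterBoundary T, h w ≤
    1) → (∀ w ∈ latticeOuterBoundary T, dist (meshPoint δ w) z₀ ≤ R → h w ≤ 0) → p ∉ Λ → dist (meshPoint δ
    p) z₀ ≤ r + δ → 0 < δ → δ ≤ r → 2 < M → M * r ≤ R → x ∈ T → dist (meshPoint δ x) z₀ < r + δ → h x ≤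
    WeakBeurling.beurlingConst * (12 / (M - 2)) ^ WeakBeurling.beurlingExp :=
  fun _ _ _ _ _ _ _ _ _ _ hΛ hT hh h1 h0 hp hpz hδ hr hM hR hxT hx =>
    le_near_wall hΛ hT hh h1 h0 hp hpz hδ hr hM hR hxT hx

end Summit.CriticalPhenomena.SAWScalingLimit.Theorems.FKGToTraversalBound.ExcursionDomination.KilledWalkCollar
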